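import Summits.CriticalPhenomena.SAWScalingLimit.Theorems.SAWSpinMonotoneQCIdentificationXiPhase

/-!
# Smirnov's primitive `Ξ = F^{8/5} dz`, IV: the boundary increments lie on one ray (helper sub-goal
(O) of `stub_rayCondition`, line `eight_fifths_primitive`, crux `QCIdentification`, stmt-CriticalPhenomena-16772)

**Setting.** As in `…XiLift`, `…XiForm`, `…XiPhase`: `Λ` simply connected, boundary source
`a = {u_a, v_a}`, `F = Fobs Λ a`, `S_v = modeSum F v`, `A_k(v) = 1 + ω^k a′_v`, `Θ` the lifted
argument, `Ξ = dXi F Θ` the discrete 1-form `F^{8/5} dz`, `bdPhase` the boundary phase of a port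
(in `2πℤ` at boundary ports, equal on the two flanks of every arc, `0` at the source).

**What.**

* the **ray formula** (`dXi_boundary_eq`, registered ∀-form `xi_dXi_boundary_eq`): at a boundary
  port `p = {v, u} ≠ a` of `Λ` (`u = hexNbr v k ∉ Λ`, `S_v ≠ 0`),
  `Ξ(p) = bdModulus · i · e^{i(8/5) bdPhase(p)} · (c(v_a) - c(u_a))` with
  `bdModulus = √3 (‖S_v‖‖A‖/3)^{8/5} > 0`: the rigid winding rotates the outward normal `c(u) - c(v)`
  back onto the inward normal at the source (`exp_winding_mul_I_eq_div_of_boundary`); at the source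
  port itself the sign is opposite (`dXi_source_eq`);
* (registered `xi_boundary_one_ray`) hence all boundary ports `p ≠ a` with a common value `E₀` of the
  boundary phase carry increments `Ξ(p) = ‖Ξ(p)‖ e^{iΘ₀}`, `‖Ξ(p)‖ > 0`, on ONE ray,
  `Θ₀ = π/2 + (8/5)E₀ + arg (c(v_a) - c(u_a))`;
* (registered `xi_boundary_ray_package`) the assembled lattice statement: with the lifted argument
  `Θ` of `xi_exists_argLift`, the phase vanishes at the source, is preserved across every arc, and
  every boundary port `p ≠ a` of vanishing phase has `Ξ(p) = ‖Ξ(p)‖ · i (c(v_a) - c(u_a))/‖…‖`,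
  `‖Ξ(p)‖ > 0` — the ray `i e^{iΘ_in(a)} ℝ_{>0}` of the stub report.

**What remains for the whole boundary.** `xi_phase_step` makes `bdPhase` constant along every
boundary cycle of the face complex `K_{Λ₀}` (consecutive boundary ports are the two flanks of one
arc, `…NoBranchingTelescope`), and `xi_bdPhase_source` pins the cycle through `a` to `0`. That the
boundary ports of the (connected, simply connected) source component form a SINGLE cycle — i.e. that a
function on boundary ports taking equal values on the two flanks of every arc is constant — is a
purely topological fact about finite face sets with connected complement, not yet in the tree; with
it `bdPhase ≡ 0` and ALL boundary increments other than the source lie on the one ray, as observed in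
every enumerated instance (`work/stubs/scratch_xi/xi_check.py`: 83 domains/sources, 828 boundary
ports).

Sources: S. Smirnov, *Towards conformal invariance of 2D lattice models*, Proc. ICM 2006
(arXiv:0708.0032) §5.6; H. Duminil-Copin, S. Smirnov, Ann. of Math. 175 (2012) 1653–1665
(arXiv:1007.0575), §3; stub report `STUB-REPORT-rayCondition.md` ((O), (R)) of this line.
-/

noncomputable section

open Complex
open Literature.Probability.LatticeModels Literature.Probability.RandomPlanarGeometry
open Literature.Probability.RandomPlanarGeometry.SAW
open Literature.Barriers.CriticalPhenomena Literature.Barriers.CriticalPhenomena.HexKernel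
open Summit.CriticalPhenomena.SAWScalingLimit.Theses.SAWDevelopingMap

namespace Summit.CriticalPhenomena.SAWScalingLimit.Cruxes.QCIdentification.EightFifthsPrimitive

namespace Xi

open NB Dev P85 Stokes

variable {Λ : Finset HexVertex} {a : Sym2 HexVertex} {ua va : HexVertex}

/-! ### The ray formula -/

/-- The modulus of the boundary increment. -/
def bdModulus (F : Sym2 HexVertex → ℂ) (v : HexVertex) (k : Fin 3) : ℝ :=
  Real.sqrt 3 * (‖modeSum F v‖ / 3 * ‖1 + omg ^ (k : ℕ) * bratio F v‖) ^ ((8 : ℝ) / 5)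

/-- The modulus is positive at a non-degenerate face under (K). -/
theorem bdModulus_pos (hK : NoFoldBound) (hΛ : hexDomainSimplyConnected Λ) (ha : a ∈ hexDomainBoundary Λ)
    {v : HexVertex} (k : Fin 3) (hv : v ∈ Λ) (hS : modeSum (Fobs Λ a) v ≠ 0) :
    0 < bdModulus (Fobs Λ a) v k := by
  have hA0 : 1 + omg ^ (k : ℕ) * bratio (Fobs Λ a) v ≠ 0 :=
    Complex.ne_zero_of_re_pos (one_add_omg_pow_mul_re_pos (p85_norm_bratio_lt_one hK hΛ ha hv hS) k)
  unfold bdModulus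
  have h3 : 0 < Real.sqrt 3 := Real.sqrt_pos.2 (by norm_num)
  have hr : 0 < ‖modeSum (Fobs Λ a) v‖ / 3 * ‖1 + omg ^ (k : ℕ) * bratio (Fobs Λ a) v‖ :=
    mul_pos (div_pos (norm_pos_iff.2 hS) (by norm_num)) (norm_pos_iff.2 hA0)
  exact mul_pos h3 (Real.rpow_pos_of_pos hr _)

/-- The `𝕋`-edge crossed by the port `k` of `v` is `√3 i (c(hexNbr v k) - c(v))`. -/
theorem edge_eq_sqrt_three (v : HexVertex) (k : Fin 3) :
    triEmbed (triVert v (k + 1)) - triEmbed (triVert v k) =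
      (Real.sqrt 3 : ℂ) * I * (hexCenter (hexNbr v k) - hexCenter v) := by
  rw [edge_eq_dart, hexMidpoint_mk]
  ring

/-- **The ray formula at a boundary port other than the source.** Under `NoFoldBound`, for a
simply connected `Λ` with boundary source `{ua, va}`, at a boundary port `(v, k)` (`v ∈ Λ`,
`u = hexNbr v k ∉ Λ`, `{u, v} ≠ {ua, va}`, `S_v ≠ 0`):
`Ξ(v, k) = bdModulus · i · e^{i(8/5) bdPhase} · (c(va) - c(ua))` — the rigid winding rotates the
outward normal `c(u) - c(v)` back onto the inward normal at the source
(`exp_winding_mul_I_eq_div_of_boundary`). -/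
theorem dXi_boundary_eq (hK : NoFoldBound) (hΛ : hexDomainSimplyConnected Λ)
    (hva : va ∈ Λ) (hua : ua ∉ Λ) (hadj : hexGraph.Adj va ua) (Θ : HexVertex → ℝ) {v : HexVertex}
    (k : Fin 3) (hv : v ∈ Λ) (hu : hexNbr v k ∉ Λ) (hne : s(hexNbr v k, v) ≠ s(ua, va))
    (hS : modeSum (Fobs Λ s(ua, va)) v ≠ 0) :
    dXi (Fobs Λ s(ua, va)) Θ v k = (bdModulus (Fobs Λ s(ua, va)) v k : ℂ) *
      (I * exp ((((8 : ℝ) / 5 * bdPhase Λ s(ua, va) Θ v k : ℝ) : ℂ) * I) *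
        (hexCenter va - hexCenter ua)) := by
  have ha : s(ua, va) ∈ hexDomainBoundary Λ := mk_mem_boundary hva hua hadj
  have hp : s(hexNbr v k, v) ∈ hexDomainBoundary Λ := mk_mem_boundary hv hu (adj_hexNbr v k)
  have hA0 : 1 + omg ^ (k : ℕ) * bratio (Fobs Λ s(ua, va)) v ≠ 0 :=
    Complex.ne_zero_of_re_pos (one_add_omg_pow_mul_re_pos (p85_norm_bratio_lt_one hK hΛ ha hv hS) k)
  have hF : Fobs Λ s(ua, va) s(hexNbr v k, v) ≠ 0 := by
    rw [show s(hexNbr v k, v) = s(v, hexNbr v k) from Sym2.eq_swap]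
    exact fobs_ne_zero_of_modeSum_ne_zero hK hΛ ha hv hS k
  obtain ⟨γ⟩ := nonempty_saw_of_fobs_ne_zero hF
  have hγ : γ.verts ≠ [] := fun h => hne (γ.eq_of_nil h).symm
  have hW : bdryWinding Λ s(ua, va) s(hexNbr v k, v) = γ.winding :=
    bdryWinding_eq_winding hΛ ha hp hne γ
  have hexp := exp_winding_mul_I_eq_div_of_boundary hua hu (adj_hexNbr v k) hadj γ hγ
  have hc : hexCenter va - hexCenter ua ≠ 0 := sub_ne_zero.2 (hexCenter_ne_of_adj hadj)
  -- the rigid winding rotates the outward normal back onto the inward normal at the source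
  have hrot : exp (-((γ.winding : ℂ) * I)) * (hexCenter (hexNbr v k) - hexCenter v) =
      hexCenter va - hexCenter ua := by
    rw [(div_eq_iff hc).1 hexp.symm, ← mul_assoc, ← Complex.exp_add, neg_add_cancel,
      Complex.exp_zero, one_mul]
  have hph : exp ((((8 : ℝ) / 5 * portArg (Fobs Λ s(ua, va)) Θ v k : ℝ) : ℂ) * I) =
      exp ((((8 : ℝ) / 5 * bdPhase Λ s(ua, va) Θ v k : ℝ) : ℂ) * I) * exp (-((γ.winding : ℂ) * I)) := by
    rw [← Complex.exp_add, bdPhase, hW]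
    congr 1
    push_cast
    ring
  rw [dXi, portPow_eq_polar _ _ _ _ hA0, edge_eq_sqrt_three, ← portArg, hph, bdModulus, ← hrot]
  push_cast
  ring

/-- **At the source port the increment is opposite**: for `v = va`, `hexNbr va k = ua`,
`Ξ(va, k) = -bdModulus · i · e^{i(8/5) bdPhase} · (c(va) - c(ua))` (`W(a) = 0`). -/
theorem dXi_source_eq (hK : NoFoldBound) (hΛ : hexDomainSimplyConnected Λ)
    (hva : va ∈ Λ) (hua : ua ∉ Λ) (hadj : hexGraph.Adj va ua) (Θ : HexVertex → ℝ)
    (k : Fin 3) (hk : hexNbr va k = ua) :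
    dXi (Fobs Λ s(ua, va)) Θ va k = -((bdModulus (Fobs Λ s(ua, va)) va k : ℂ) *
      (I * exp ((((8 : ℝ) / 5 * bdPhase Λ s(ua, va) Θ va k : ℝ) : ℂ) * I) *
        (hexCenter va - hexCenter ua))) := by
  have ha : s(ua, va) ∈ hexDomainBoundary Λ := mk_mem_boundary hva hua hadj
  have hS := modeSum_source_ne_zero hK hΛ hva hua hadj
  have hA0 : 1 + omg ^ (k : ℕ) * bratio (Fobs Λ s(ua, va)) va ≠ 0 :=
    Complex.ne_zero_of_re_pos (one_add_omg_pow_mul_re_pos (p85_norm_bratio_lt_one hK hΛ ha hva hS) k)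
  have hW : bdryWinding Λ s(ua, va) s(hexNbr va k, va) = 0 := by
    rw [hk, bdryWinding_self]
  have hph : portArg (Fobs Λ s(ua, va)) Θ va k = bdPhase Λ s(ua, va) Θ va k := by
    rw [bdPhase, hW, mul_zero, add_zero]
  rw [dXi, portPow_eq_polar _ _ _ _ hA0, edge_eq_sqrt_three, ← portArg, hph, bdModulus, hk]
  push_cast
  ring

/-- **The boundary increments with a common phase lie on one ray (registered).** Under
`NoFoldBound`, for a simply connected `Λ` with boundary source `{ua, va}`, any `Θ` and any real `E₀`
there is a direction `Θ₀` such that at every boundary port `(v, k)` of `Λ` other than the source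
(`v ∈ Λ`, `hexNbr v k ∉ Λ`, `S_v ≠ 0`, `{hexNbr v k, v} ≠ {ua, va}`) whose boundary phase is `E₀`,
the increment `Ξ(v, k) = dXi F Θ v k` is the non-zero positive multiple `‖Ξ‖ e^{iΘ₀}` of the unit
vector `e^{iΘ₀}` (`Θ₀ = π/2 + (8/5)E₀ + arg (c(va) - c(ua))`). With the lifted argument of
`xi_exists_argLift`, `xi_phase_step` equates the phases of consecutive boundary ports of the source
component, and `xi_bdPhase_int` makes them integer multiples of `2π`. -/
theorem xi_boundary_one_ray : NoFoldBound → ∀ {Λ : Finset HexVertex}, hexDomainSimplyConnected Λ → ∀ {ua va : HexVertex}, va ∈ Λ → ua ∉ Λ → hexGraph.Adj va ua → ∀ (Θ : HexVertex → ℝ) (E₀ : ℝ) (v : HexVertex) (k : Fin 3), v ∈ Λ → hexNbr v k ∉ Λ → modeSum (Fobs Λ s(ua, va)) v ≠ 0 → s(hexNbr v k, v) ≠ s(ua, va) → Xi.bdPhase Λ s(ua, va) Θ v k = E₀ → Xi.dXi (Fobs Λ s(ua, va)) Θ v k = (‖Xi.dXi (Fobs Λ s(ua, va)) Θ v k‖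 : ℂ) * Complex.exp ((Real.pi / 2 + (8 : ℝ) / 5 * E₀ + Complex.arg (hexCenter va - hexCenter ua) : ℝ) * Complex.I) ∧ 0 < ‖Xi.dXi (Fobs Λ s(ua, va)) Θ v k‖ := by
  intro hK Λ hΛ ua va hva hua hadj Θ E₀ v k hv hu hS hne hE
  have ha : s(ua, va) ∈ hexDomainBoundary Λ := mk_mem_boundary hva hua hadj
  have hc : hexCenter va - hexCenter ua ≠ 0 := sub_ne_zero.2 (hexCenter_ne_of_adj hadj)
  have hform := dXi_boundary_eq hK hΛ hva hua hadj Θ k hv hu hne hS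
  rw [hE] at hform
  have hρ := bdModulus_pos hK hΛ ha k hv hS
  -- the unit direction
  have hdir : I * exp ((((8 : ℝ) / 5 * E₀ : ℝ) : ℂ) * I) * (hexCenter va - hexCenter ua) =
      (‖hexCenter va - hexCenter ua‖ : ℂ) *
        exp (((Real.pi / 2 + (8 : ℝ) / 5 * E₀ + arg (hexCenter va - hexCenter ua) : ℝ) : ℂ) * I) := by
    have h3 : exp (((Real.pi / 2 + (8 : ℝ) / 5 * E₀ + arg (hexCenter va - hexCenter ua) : ℝ) : ℂ) * I) =
        exp ((Real.pi : ℂ) / 2 * I) * exp ((((8 : ℝ) / 5 * E₀ : ℝ) : ℂ) * I) *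
          exp ((arg (hexCenter va - hexCenter ua) : ℂ) * I) := by
      rw [← Complex.exp_add, ← Complex.exp_add]
      congr 1
      push_cast
      ring
    rw [h3, Complex.exp_pi_div_two_mul_I]
    conv_lhs => rw [← norm_mul_exp_arg_mul_I (hexCenter va - hexCenter ua)]
    ring
  rw [hdir] at hform
  have hn : ‖dXi (Fobs Λ s(ua, va)) Θ v k‖ =
      bdModulus (Fobs Λ s(ua, va)) v k * ‖hexCenter va - hexCenter ua‖ := by
    rw [hform, norm_mul, norm_mul, Complex.norm_real, Complex.norm_real,
      Complex.norm_exp_ofReal_mul_I, mul_one, Real.norm_of_nonneg hρ.le,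
      Real.norm_of_nonneg (norm_nonneg _)]
  refine ⟨?_, ?_⟩
  · rw [hn, hform]
    push_cast
    ring
  · rw [hn]
    exact mul_pos hρ (norm_pos_iff.2 hc)

/-- **The ray formula (registered ∀-form).** Under `NoFoldBound`, for a simply connected `Λ` with
boundary source `{ua, va}`, any `Θ`, and a boundary port `(v, k)` other than the source (`v ∈ Λ`,
`hexNbr v k ∉ Λ`, `{hexNbr v k, v} ≠ {ua, va}`, `S_v ≠ 0`):
`dXi F Θ v k = bdModulus F v k · (i · e^{i(8/5) bdPhase} · (c(va) - c(ua)))`, `bdModulus F v k > 0`. -/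
theorem xi_dXi_boundary_eq : NoFoldBound → ∀ {Λ : Finset HexVertex}, hexDomainSimplyConnected Λ → ∀ {ua va : HexVertex}, va ∈ Λ → ua ∉ Λ → hexGraph.Adj va ua → ∀ (Θ : HexVertex → ℝ) {v : HexVertex} (k : Fin 3), v ∈ Λ → hexNbr v k ∉ Λ → s(hexNbr v k, v) ≠ s(ua, va) → modeSum (Fobs Λ s(ua, va)) v ≠ 0 → Xi.dXi (Fobs Λ s(ua, va)) Θ v k = (Xi.bdModulus (Fobs Λ s(ua, va)) v k : ℂ) * (Complex.I * Complex.exp ((((8 : ℝ) / 5 * Xi.bdPhase Λ s(ua, va) Θ v k : ℝ) : ℂ) * Complex.I) * (hexCenter va - hexCenter ua)) ∧ 0 < Xi.bdModulus (Fobs Λ s(ua, va)) v k :=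
  fun hK _ hΛ _ _ hva hua hadj Θ _ k hv hu hne hS =>
    ⟨dXi_boundary_eq hK hΛ hva hua hadj Θ k hv hu hne hS,
      bdModulus_pos hK hΛ (mk_mem_boundary hva hua hadj) k hv hS⟩

/-- **The assembled lattice statement (registered).** Under `NoFoldBound`, for a simply connected
`Λ` with boundary source `{ua, va}` (`va ∈ Λ`, `ua ∉ Λ`, adjacent) there is a lifted argument `Θ`
(increments `arg (S_w/S_v)` on the source component, `Θ_v ≡ arg S_v`, `Θ_{va} = arg S_{va}`) such
that: the boundary phase vanishes at the source port; it is preserved across every arc of faces with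
non-zero modes and outer flanks; and every boundary port `p = {v, hexNbr v k} ≠ a` (`v ∈ Λ`,
`hexNbr v k ∉ Λ`, `S_v ≠ 0`) of vanishing phase carries the increment
`Ξ(p) = ‖Ξ(p)‖ e^{i(π/2 + arg (c(va) - c(ua)))}`, `‖Ξ(p)‖ > 0`: the ray `i (c(va) - c(ua)) ℝ_{>0}`. -/
theorem xi_boundary_ray_package : NoFoldBound → ∀ {Λ : Finset HexVertex}, hexDomainSimplyConnected Λ → ∀ {ua va : HexVertex}, va ∈ Λ → ua ∉ Λ → hexGraph.Adj va ua → ∃ Θ : HexVertex → ℝ, (∀ v ∈ NB.srcComp Λ va, ∀ w ∈ NB.srcComp Λ va, hexGraph.Adj v w → Θ w - Θ v = Complex.arg (modeSum (Fobs Λ s(ua, va)) w / modeSum (Fobs Λ s(ua, va)) v)) ∧ (∀ v ∈ NB.srcComp Λ va, (Θ v : Real.Angle) = Complex.arg (modeSum (Fobs Λ s(ua, va)) v)) ∧ (∀ k : Fin 3, hexNbr va k = ua → Xi.bdPhase Λ s(ua, va) Θ va k = 0) ∧ (∀ (s : Site 2) (j m : Fin 6), m ≠ 0 → HexKernel.face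 s j ∉ Λ → (∀ i : Fin 6, i < m → HexKernel.face s (j + 1 + i) ∈ Λ) → HexKernel.face s (j + 1 + m) ∉ Λ → (∀ i : Fin 6, i < m → modeSum (Fobs Λ s(ua, va)) (HexKernel.face s (j + 1 + i)) ≠ 0) → Xi.bdPhase Λ s(ua, va) Θ (HexKernel.face s (j + 1)) (arcCornerIdx (j + 1) + 1) = Xi.bdPhase Λ s(ua, va) Θ (HexKernel.face s (j + m)) (arcCornerIdx (j + m))) ∧ (∀ (v : HexVertex) (k : Fin 3), v ∈ Λ → hexNbr v k ∉ Λ → modeSum (Fobs Λ s(ua, va)) v ≠ 0 → s(hexNbr v k, v) ≠ s(ua, va) → Xi.bdPhase Λ s(ua, va) Θ v k = 0 → Xi.dXi (Fobs Λ s(ua, va)) Θ v k = (‖Xi.dXi (Fobs Λ s(ua, va)) Θ v k‖ : ℂ) * Complex.exp ((Real.pi / 2 + Complex.arg (hexCenter va - hexCenter ua) : ℝ) * Complex.I) ∧ 0 < ‖Xi.dXi (Fobs Λ s(ua, va)) Θ v k‖) := by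
  intro hK Λ hΛ ua va hva hua hadj
  obtain ⟨Θ, hinc, hang, hnorm⟩ := xi_exists_argLift hK hΛ hva hua hadj
  refine ⟨Θ, hinc, hang, fun k hk => xi_bdPhase_source hK hΛ hva hua hadj Θ k hk hnorm,
    fun s j m hm hout hin hout' hS => xi_phase_step hK hΛ hva hua hadj Θ hinc s j m hm hout hin hout' hS,
    fun v k hv hu hS hne hE => ?_⟩
  have h := xi_boundary_one_ray hK hΛ hva hua hadj Θ 0 v k hv hu hS hne hE
  rwa [mul_zero, add_zero] at h

end Xi

end Summit.CriticalPhenomena.SAWScalingLimit.Cruxes.QCIdentification.EightFifthsPrimitive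

end
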